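import Summits.AtomisticToContinuum.FouriersLaw.Theorems.BondHeatUncertaintyExtensiveSnapshotIrreversibilityEnergyWindowOddMomentChain

/-!
# Crux `ExtensiveSnapshotIrreversibility` (stmt-AtomisticToContinuum-9121), fixed-`N` half `K_fix`:
the LADDER in the exponent `p` of the graded atom `A2ₚ` (node «OddLogRatioMomentLadder», part 3/3)

(helper file, theorem-side; decomp-a2c lens-1 «grading / quantitative ladder», generation 88.)

With `ψ_δ := φ_δ − φ_δ∘Θ` the odd log-density of the steady state `μ_δ = μ_T · e^{φ_δ}` (= the
log-likelihood ratio `log dμ_δ/dΘ_*μ_δ`), the rungs of clause (T2o) by integrability exponent: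

* `p = ∞` ⟹ every `p`: `nessOddLogRatioMoment_of_bound` — A1 ∧ A2 ⟹ A2ₚ for all `p > 0`
  (`|ψ|ᵖ ≤ C₂ᵖ(1 + H)^{kp} ≤ C₂ᵖ Mᵖ e^{θH}`, integrated against `μ_δ` by A1; blow-up `r = 0`): the
  atom of record A2 sits at the TOP of the ladder, so every junction through A2 factors through A2ₚ
  (`snapshotKLUpperExpansion_of_atoms₅K_via_moment`).
* antitone in `p`: `nessOddLogRatioMoment_anti` — `A2ₚ ⟹ A2ₚ'` for `0 < p' ≤ p`
  (`|ψ|^{p'} ≤ 1 + |ψ|ᵖ`); `p > 1` ⟹ `K_fix` (given A0, A1, A3, A4): part 2.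
* `p = 1`, SIGNED, with the sharp constant IS `K_fix`: `NessOddLogRatioMean` —
  `ψ_δ ∈ L¹(μ_δ)` and `∫ ψ_δ dμ_δ ≤ K δ²` eventually for every `K > ½ ∫ (h − h∘Θ)² dμ_T` — and
  `snapshotKLUpperExpansion_iff_oddLogRatioMean` (`KL(μ_δ ‖ Θ_*μ_δ) = ∫ ψ_δ dμ_δ` when finite,
  `Negative.toReal_klDiv_flip_tilted`, `klDiv_flip_tilted_ne_top_iff`).  This rung is a COSTUME of
  `K_fix` and is filed only to calibrate the ladder: the theorems stop between the signed first
  moment with constant `Kδ²` (≡ target) and ANY moment `p > 1` with ANY polynomial blow-up (sufficient,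
  given the other atoms).

No new objects. [folklore]  References: as in `…EnergyWindowTree`.
-/

noncomputable section

namespace Summit.AtomisticToContinuum.FouriersLaw.Theorems.ExtensiveSnapshotIrreversibility.EnergyWindow

open MeasureTheory Filter Topology InformationTheory Real
open scoped ENNReal NNReal
open Literature.MathematicalPhysics.KineticTheory.HeatConduction
open Summit.AtomisticToContinuum.FouriersLaw.Theorems.ExtensiveSnapshotIrreversibility.Negative
open Summit.AtomisticToContinuum.FouriersLaw.Theorems.ExtensiveSnapshotIrreversibility.ClausiusBudget.OddLogDensity

variable {N : ℕ}

/-! ## 1. The top rung: the pointwise atom A2 (with A1) gives every moment -/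

/-- **A1 ∧ A2 ⟹ A2ₚ for every `p > 0`** (`|φ − φ∘Θ|ᵖ ≤ (C₂⁺)ᵖ (1 + H)^{kp} ≤ (C₂⁺ M)ᵖ e^{θH}`
with `M = k! e^{θ/p}/(θ/p)^k`, `μ_T`-a.e. hence `μ_δ`-a.e. (`μ_δ ≪ μ_T`), integrated by A1; blow-up
exponent `r = 0`). [folklore] -/
theorem nessOddLogRatioMoment_of_bound (h1 : NessExpMomentBound) (h2 : NessOddLogRatioBound)
    {p : ℝ} (hp : 0 < p) : NessOddLogRatioMoment p := by
  intro ω₂ lam β γ hω hl hβ hγ hU μ hμ T hT N hN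
  obtain ⟨δ₁, θ, C₁, hδ₁, hθ, hT1⟩ := h1 ω₂ lam β γ hω hl hβ hγ hU μ hμ T hT N hN
  obtain ⟨δ₂, C₂, k, hδ₂, hT2⟩ := h2 ω₂ lam β γ hω hl hβ hγ hU μ hμ T hT N hN
  set H : PhaseSpace N → ℝ := (pinnedChain ω₂ lam β γ).hamiltonian N with hHdef
  have hH0 : ∀ x, 0 ≤ H x := pinnedChain_hamiltonian_nonneg hω.le hl.le hβ.le γ N
  have hp0 : p ≠ 0 := hp.ne'
  set C₂' : ℝ := max C₂ 0 with hC₂'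
  have hC₂' : 0 ≤ C₂' := le_max_right _ _
  set M : ℝ := k.factorial * exp (θ / p) / (θ / p) ^ k with hM
  have hMpos : 0 < M := by rw [hM]; positivity
  refine ⟨min δ₁ δ₂, (C₂' * M) ^ p * C₁, 0, lt_min hδ₁ hδ₂, fun δ hδ hδ' φ hφm hrew => ?_⟩
  have hδ1' : |δ| < δ₁ := hδ'.trans_le (min_le_left _ _)
  have hδ2' : |δ| < δ₂ := hδ'.trans_le (min_le_right _ _)
  obtain ⟨hI1, hle1⟩ := hT1 δ hδ hδ1'
  have hae := hT2 δ hδ hδ2' φ hφm hrew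
  have hac : μ N (T + δ / 2) (T - δ / 2) ≪ (pinnedChain ω₂ lam β γ).gibbsMeasure N T := by
    rw [hrew]
    exact withDensity_absolutelyContinuous _ _
  have hpt : ∀ᵐ x ∂(μ N (T + δ / 2) (T - δ / 2)),
      |φ x - φ (x.1, -x.2)| ^ p ≤ (C₂' * M) ^ p * exp (θ * H x) := by
    filter_upwards [hac.ae_le hae] with x hx
    have h1x : |φ x - φ (x.1, -x.2)| ≤ C₂' * M * exp (θ / p * H x) := by
      calc |φ x - φ (x.1, -x.2)| ≤ C₂ * (1 + H x) ^ k := hx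
        _ ≤ C₂' * (1 + H x) ^ k :=
            mul_le_mul_of_nonneg_right (le_max_left _ _) (pow_nonneg (by linarith [hH0 x]) _)
        _ ≤ C₂' * (M * exp (θ / p * H x)) :=
            mul_le_mul_of_nonneg_left (one_add_pow_le_factorial_mul_exp k (hH0 x) (by positivity)) hC₂'
        _ = C₂' * M * exp (θ / p * H x) := by ring
    calc |φ x - φ (x.1, -x.2)| ^ p ≤ (C₂' * M * exp (θ / p * H x)) ^ p :=
          Real.rpow_le_rpow (abs_nonneg _) h1x hp.le
      _ = (C₂' * M) ^ p * exp (θ * H x) := by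
          rw [Real.mul_rpow (by positivity) (exp_pos _).le, ← Real.exp_mul]
          congr 2
          field_simp
  have hmeas : AEStronglyMeasurable (fun x => |φ x - φ (x.1, -x.2)| ^ p)
      (μ N (T + δ / 2) (T - δ / 2)) :=
    ((continuous_abs.measurable.comp (hφm.sub (hφm.comp measurable_flip))).pow_const p).aestronglyMeasurable
  have hint : Integrable (fun x => |φ x - φ (x.1, -x.2)| ^ p) (μ N (T + δ / 2) (T - δ / 2)) := by
    refine (hI1.const_mul ((C₂' * M) ^ p)).mono' hmeas ?_
    filter_upwards [hpt] with x hx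
    rw [Real.norm_eq_abs, abs_of_nonneg (Real.rpow_nonneg (abs_nonneg _) _)]
    exact hx
  refine ⟨hint, ?_⟩
  rw [neg_zero, Real.rpow_zero, mul_one]
  calc ∫ x, |φ x - φ (x.1, -x.2)| ^ p ∂(μ N (T + δ / 2) (T - δ / 2))
      ≤ ∫ x, (C₂' * M) ^ p * exp (θ * H x) ∂(μ N (T + δ / 2) (T - δ / 2)) :=
        integral_mono_ae hint (hI1.const_mul _) hpt
    _ = (C₂' * M) ^ p * ∫ x, exp (θ * H x) ∂(μ N (T + δ / 2) (T - δ / 2)) := integral_const_mul _ _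
    _ ≤ (C₂' * M) ^ p * C₁ := mul_le_mul_of_nonneg_left hle1 (by positivity)

/-- **The graded junction subsumes the junction of record**: `K_fix ⟸ A0 ∧ A2 ∧ S3 ∧ A3p ∧ A4`
re-derived THROUGH `A2₂` (`nessOddLogRatioMoment_of_bound` at `p = 2`,
`snapshotKLUpperExpansion_of_atoms_moment₅K`). [folklore] -/
private theorem snapshotKLUpperExpansion_of_atoms₅K_via_moment (h0 : NessGibbsReweighting)
    (h2 : NessOddLogRatioBound) (h3 : KernelTemperatureLipschitz) (h3p : NessFloorMeanValue)
    (h4 : NessLinearResponseL2) : SnapshotKLUpperExpansion :=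
  snapshotKLUpperExpansion_of_atoms_moment₅K one_lt_two h0
    (nessOddLogRatioMoment_of_bound nessExpMomentBound_holds h2 two_pos) h3 h3p h4

/-! ## 2. The ladder is antitone in `p` -/

/-- **`A2ₚ ⟹ A2ₚ'` for `0 < p' ≤ p`** (`|ψ|^{p'} ≤ 1 + |ψ|ᵖ` pointwise and `μ_δ` is a probability
measure for `|δ| < 2T`; constants `1 + C⁺`, blow-up `r⁺`, radius `min(δ₀, 1, 2T)`). [folklore] -/
theorem nessOddLogRatioMoment_anti {p p' : ℝ} (hp' : 0 < p') (hpp' : p' ≤ p)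
    (h : NessOddLogRatioMoment p) : NessOddLogRatioMoment p' := by
  intro ω₂ lam β γ hω hl hβ hγ hU μ hμ T hT N hN
  obtain ⟨δ₀, C, r, hδ₀, hmom⟩ := h ω₂ lam β γ hω hl hβ hγ hU μ hμ T hT N hN
  have h2T : (0 : ℝ) < 2 * T := by positivity
  refine ⟨min (min δ₀ 1) (2 * T), 1 + max C 0, max r 0, lt_min (lt_min hδ₀ one_pos) h2T,
    fun δ hδ hδ' φ hφm hrew => ?_⟩
  have hδ₀' : |δ| < δ₀ := hδ'.trans_le ((min_le_left _ _).trans (min_le_left _ _))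
  have hδ1 : |δ| < 1 := hδ'.trans_le ((min_le_left _ _).trans (min_le_right _ _))
  have hδT : |δ| < 2 * T := hδ'.trans_le (min_le_right _ _)
  have hδpos : 0 < |δ| := abs_pos.2 hδ
  obtain ⟨hlo, hhi⟩ := abs_lt.1 hδT
  haveI : IsProbabilityMeasure (μ N (T + δ / 2) (T - δ / 2)) :=
    (hμ N _ _ (by linarith) (by linarith)).1
  obtain ⟨hint, hle⟩ := hmom δ hδ hδ₀' φ hφm hrew
  have hpt : ∀ x : PhaseSpace N, |φ x - φ (x.1, -x.2)| ^ p' ≤ 1 + |φ x - φ (x.1, -x.2)| ^ p := by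
    intro x
    have ht0 : 0 ≤ |φ x - φ (x.1, -x.2)| := abs_nonneg _
    have hnn : 0 ≤ |φ x - φ (x.1, -x.2)| ^ p := Real.rpow_nonneg ht0 _
    rcases le_or_gt |φ x - φ (x.1, -x.2)| 1 with h1 | h1
    · have : |φ x - φ (x.1, -x.2)| ^ p' ≤ 1 := Real.rpow_le_one ht0 h1 hp'.le
      linarith
    · have : |φ x - φ (x.1, -x.2)| ^ p' ≤ |φ x - φ (x.1, -x.2)| ^ p :=
        Real.rpow_le_rpow_of_exponent_le h1.le hpp'
      linarith
  have hmeas : AEStronglyMeasurable (fun x => |φ x - φ (x.1, -x.2)| ^ p')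
      (μ N (T + δ / 2) (T - δ / 2)) :=
    ((continuous_abs.measurable.comp (hφm.sub (hφm.comp measurable_flip))).pow_const p').aestronglyMeasurable
  have hdom : Integrable (fun x => 1 + |φ x - φ (x.1, -x.2)| ^ p) (μ N (T + δ / 2) (T - δ / 2)) :=
    (integrable_const 1).add hint
  have hint' : Integrable (fun x => |φ x - φ (x.1, -x.2)| ^ p') (μ N (T + δ / 2) (T - δ / 2)) := by
    refine hdom.mono' hmeas (ae_of_all _ fun x => ?_)
    rw [Real.norm_eq_abs, abs_of_nonneg (Real.rpow_nonneg (abs_nonneg _) _)]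
    exact hpt x
  refine ⟨hint', ?_⟩
  have hone : ∫ x, (1 : ℝ) ∂(μ N (T + δ / 2) (T - δ / 2)) = 1 := by simp
  have hI : ∫ x, |φ x - φ (x.1, -x.2)| ^ p' ∂(μ N (T + δ / 2) (T - δ / 2)) ≤ 1 + C * |δ| ^ (-r) := by
    calc ∫ x, |φ x - φ (x.1, -x.2)| ^ p' ∂(μ N (T + δ / 2) (T - δ / 2))
        ≤ ∫ x, (1 + |φ x - φ (x.1, -x.2)| ^ p) ∂(μ N (T + δ / 2) (T - δ / 2)) :=
          integral_mono_ae hint' hdom (ae_of_all _ hpt)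
      _ = 1 + ∫ x, |φ x - φ (x.1, -x.2)| ^ p ∂(μ N (T + δ / 2) (T - δ / 2)) := by
          rw [integral_add (integrable_const 1) hint, hone]
      _ ≤ 1 + C * |δ| ^ (-r) := by linarith
  have hr1 : 1 ≤ |δ| ^ (-(max r 0)) :=
    Real.one_le_rpow_of_pos_of_le_one_of_nonpos hδpos hδ1.le (neg_nonpos.2 (le_max_right _ _))
  have hr2 : |δ| ^ (-r) ≤ |δ| ^ (-(max r 0)) :=
    Real.rpow_le_rpow_of_exponent_ge hδpos hδ1.le (neg_le_neg (le_max_left _ _))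
  have hC : C * |δ| ^ (-r) ≤ max C 0 * |δ| ^ (-(max r 0)) :=
    calc C * |δ| ^ (-r) ≤ max C 0 * |δ| ^ (-r) :=
          mul_le_mul_of_nonneg_right (le_max_left _ _) (Real.rpow_nonneg (abs_nonneg _) _)
      _ ≤ max C 0 * |δ| ^ (-(max r 0)) := mul_le_mul_of_nonneg_left hr2 (le_max_right _ _)
  calc ∫ x, |φ x - φ (x.1, -x.2)| ^ p' ∂(μ N (T + δ / 2) (T - δ / 2)) ≤ 1 + C * |δ| ^ (-r) := hI
    _ ≤ 1 * |δ| ^ (-(max r 0)) + max C 0 * |δ| ^ (-(max r 0)) := by linarith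
    _ = (1 + max C 0) * |δ| ^ (-(max r 0)) := by ring

/-! ## 3. The bottom rung: the signed first moment with the sharp constant IS `K_fix` -/

/-- **`NessOddLogRatioMean` (the `p = 1` rung, SIGNED, sharp constant):** under the prefix and the
response hypotheses of `K_fix`, for every `K > ½ ∫ (h − h∘Θ)² dμ_{N,T,T}`, eventually in `δ ≠ 0`, for
every measurable reweighting exponent `φ` (`μ_{N,T+δ/2,T−δ/2} = μ_T · e^{φ}`): `φ − φ∘Θ ∈ L¹` of the
steady state and `∫ (φ − φ∘Θ) dμ_{N,T+δ/2,T−δ/2} ≤ K δ²`.  A COSTUME of `K_fix`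
(`snapshotKLUpperExpansion_iff_oddLogRatioMean`): the calibration point of the ladder.
[route statement · this cell; NOT a literature fact] -/
def NessOddLogRatioMean : Prop :=
  ∀ ω₂ lam β γ : ℝ, 0 < ω₂ → 0 < lam → 0 < β → 0 < γ →
    (∀ (N : ℕ) (T_L T_R : ℝ), 0 < T_L → 0 < T_R → ∀ μ ν : Measure (PhaseSpace N),
      (pinnedChain ω₂ lam β γ).IsSteadyState N T_L T_R μ →
      (pinnedChain ω₂ lam β γ).IsSteadyState N T_L T_R ν → μ = ν) →
    ∀ μ : (N : ℕ) → ℝ → ℝ → Measure (PhaseSpace N),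
      (∀ (N : ℕ) (T_L T_R : ℝ), 0 < T_L → 0 < T_R →
        (pinnedChain ω₂ lam β γ).IsSteadyState N T_L T_R (μ N T_L T_R)) →
      ∀ T : ℝ, 0 < T → ∀ N : ℕ, 2 ≤ N → ∀ h : PhaseSpace N → ℝ,
        (MemLp h 2 (μ N T T) ∧
          (∀ F : PhaseSpace N → ℝ, ContDiff ℝ ((⊤ : ℕ∞) : WithTop ℕ∞) F → HasCompactSupport F →
            Tendsto (fun δ : ℝ => ((∫ x, F x ∂(μ N (T + δ / 2) (T - δ / 2))) - ∫ x, F x ∂(μ N T T)) / δ)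
              (𝓝[≠] (0 : ℝ)) (𝓝 (∫ x, F x * h x ∂(μ N T T)))) ∧
          (∀ i : Fin N, Tendsto (fun δ : ℝ =>
              ((∫ x, (pinnedChain ω₂ lam β γ).bondCurrent N i x ∂(μ N (T + δ / 2) (T - δ / 2))) -
                ∫ x, (pinnedChain ω₂ lam β γ).bondCurrent N i x ∂(μ N T T)) / δ)
              (𝓝[≠] (0 : ℝ)) (𝓝 (∫ x, (pinnedChain ω₂ lam β γ).bondCurrent N i x * h x ∂(μ N T T))))) →
        ∀ K : ℝ, (1 / 2 : ℝ) * ∫ x, (h x - h (x.1, -x.2)) ^ 2 ∂(μ N T T) < K →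
          ∀ᶠ δ in 𝓝[≠] (0 : ℝ), ∀ φ : PhaseSpace N → ℝ, Measurable φ →
            μ N (T + δ / 2) (T - δ / 2) =
              ((pinnedChain ω₂ lam β γ).gibbsMeasure N T).withDensity
                (fun x => ENNReal.ofReal (Real.exp (φ x))) →
            Integrable (fun x => φ x - φ (x.1, -x.2)) (μ N (T + δ / 2) (T - δ / 2)) ∧
              ∫ x, (φ x - φ (x.1, -x.2)) ∂(μ N (T + δ / 2) (T - δ / 2)) ≤ K * δ ^ 2

/-- **`K_fix ⟹` the signed first moment** (`KL < ∞ ⟺ ψ ∈ L¹(μ_δ)`, `KL = ∫ ψ dμ_δ`). [folklore] -/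
theorem nessOddLogRatioMean_of_snapshotKLUpperExpansion (hK : SnapshotKLUpperExpansion) :
    NessOddLogRatioMean := by
  intro ω₂ lam β γ hω₂ hlam hβ hγ hU μ hμ T hT N hN h hh K hKh
  have hev := hK ω₂ lam β γ hω₂ hlam hβ hγ hU μ hμ T hT N hN h hh K hKh
  set P := pinnedChain ω₂ lam β γ with hP
  set μT := P.gibbsMeasure N T with hμT
  haveI hprob : IsProbabilityMeasure μT :=
    pinnedChain_isProbabilityMeasure_gibbsMeasure hω₂ hlam.le hβ.le γ N hT
  have hinv : μT.map (fun x : PhaseSpace N => (x.1, -x.2)) = μT := gibbsMeasure_map_flip P N T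
  filter_upwards [hev, eventually_bath_temps_pos hT] with δ hKL hδT φ hφm hrew
  haveI : IsProbabilityMeasure (μ N (T + δ / 2) (T - δ / 2)) := (hμ N _ _ hδT.1 hδT.2).1
  obtain ⟨hi, -, htilt⟩ := tilted_of_withDensity_exp hφm hrew
  rw [htilt] at hKL ⊢
  have hfin : klDiv (μT.tilted φ) ((μT.tilted φ).map (fun x : PhaseSpace N => (x.1, -x.2))) ≠ ∞ :=
    ne_top_of_le_ne_top ENNReal.ofReal_ne_top hKL
  have hint : Integrable (fun x => φ x - φ (x.1, -x.2)) (μT.tilted φ) :=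
    (klDiv_flip_tilted_ne_top_iff hinv hφm hi).1 hfin
  refine ⟨hint, ?_⟩
  have hK0 : 0 ≤ K := by
    have h0 : 0 ≤ ∫ x, (h x - h (x.1, -x.2)) ^ 2 ∂(μ N T T) := integral_nonneg fun x => sq_nonneg _
    linarith
  rw [← toReal_klDiv_flip_tilted hinv hφm hi]
  exact ENNReal.toReal_le_of_le_ofReal (mul_nonneg hK0 (sq_nonneg δ)) hKL

/-- **The signed first moment `⟹ K_fix`, given A0** (the A0 exponent is a reweighting exponent;
`KL = ∫ ψ dμ_δ` once `ψ ∈ L¹(μ_δ)`). [folklore] -/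
theorem snapshotKLUpperExpansion_of_oddLogRatioMean (h0 : NessGibbsReweighting)
    (hM : NessOddLogRatioMean) : SnapshotKLUpperExpansion := by
  intro ω₂ lam β γ hω₂ hlam hβ hγ hU μ hμ T hT N hN h hh K hKh
  obtain ⟨φ, hφm, hW0⟩ := h0 ω₂ lam β γ hω₂ hlam hβ hγ hU μ hμ T hT N hN
  have hev := hM ω₂ lam β γ hω₂ hlam hβ hγ hU μ hμ T hT N hN h hh K hKh
  set P := pinnedChain ω₂ lam β γ with hP
  set μT := P.gibbsMeasure N T with hμT
  haveI hprob : IsProbabilityMeasure μT :=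
    pinnedChain_isProbabilityMeasure_gibbsMeasure hω₂ hlam.le hβ.le γ N hT
  have hinv : μT.map (fun x : PhaseSpace N => (x.1, -x.2)) = μT := gibbsMeasure_map_flip P N T
  have h2T : (0 : ℝ) < 2 * T := by positivity
  filter_upwards [hev, eventually_bath_temps_pos hT, eventually_ne_and_abs_lt h2T] with δ hMδ hδT hδ2
  haveI : IsProbabilityMeasure (μ N (T + δ / 2) (T - δ / 2)) := (hμ N _ _ hδT.1 hδT.2).1
  have hrew := hW0 δ hδ2.2
  obtain ⟨hint, hle⟩ := hMδ (φ δ) (hφm δ) hrew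
  obtain ⟨hi, -, htilt⟩ := tilted_of_withDensity_exp (hφm δ) hrew
  rw [htilt] at hint hle ⊢
  have hfin : klDiv (μT.tilted (φ δ)) ((μT.tilted (φ δ)).map (fun x : PhaseSpace N => (x.1, -x.2))) ≠ ∞ :=
    (klDiv_flip_tilted_ne_top_iff hinv (hφm δ) hi).2 hint
  rw [← ENNReal.ofReal_toReal hfin, toReal_klDiv_flip_tilted hinv (hφm δ) hi]
  exact ENNReal.ofReal_le_ofReal hle

/-- **Calibration: `K_fix ⟺` the signed first-moment rung** (given A0). [folklore] -/
theorem snapshotKLUpperExpansion_iff_oddLogRatioMean (h0 : NessGibbsReweighting) :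
    SnapshotKLUpperExpansion ↔ NessOddLogRatioMean :=
  ⟨nessOddLogRatioMean_of_snapshotKLUpperExpansion, snapshotKLUpperExpansion_of_oddLogRatioMean h0⟩

/-! ## 4. Below the ladder: the UNSIGNED first moment is free given any polynomial KL bound

`∫ |ψ| dμ = KL(μ ‖ Θ_*μ) + 2 ∫ ψ₋ dμ` and `∫ ψ₋ dμ ≤ 1/e` for EVERY tilt of a flip-invariant
probability measure (`ψ₋ e^{φ} ≤ e^{φ∘Θ}/e` pointwise): so the `p = 1` rung of A2ₚ follows from a
`δ`-POLYNOMIAL bound on the snapshot KL itself (`NessSnapshotKLPolyBound`, far below the `Kδ²` of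
`K_fix`).  The content of A2ₚ that the seam consumes is therefore exactly the upgrade `L¹ → Lᵖ`, `p > 1`
(uniform integrability of the log-likelihood ratio `log dμ_δ/dΘ_*μ_δ` under `μ_δ`). -/

/-- `max (b − a) 0 · eᵃ ≤ e⁻¹ eᵇ` (`t ≤ e^{t−1}`). [folklore] -/
theorem posPart_sub_mul_exp_le (a b : ℝ) : max (b - a) 0 * exp a ≤ exp (-1) * exp b := by
  rcases le_or_gt b a with h | h
  · rw [max_eq_right (by linarith), zero_mul]
    positivity
  · rw [max_eq_left (by linarith)]
    have h1 : b - a ≤ exp (b - a - 1) := by linarith [add_one_le_exp (b - a - 1)]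
    calc (b - a) * exp a ≤ exp (b - a - 1) * exp a := mul_le_mul_of_nonneg_right h1 (exp_pos a).le
      _ = exp (-1) * exp b := by rw [← exp_add, ← exp_add]; ring_nf

section NegativePart

variable (μ₀ : Measure (PhaseSpace N))

/-- **The negative part of the odd log-density costs at most `1/e`**: for a flip-invariant probability
measure `μ₀` and a normalised tilt `μ = μ₀ · e^{φ}`, `∫ (φ∘Θ − φ)₊ dμ ≤ e⁻¹`
(`(φ∘Θ − φ)₊ e^{φ} ≤ e^{φ∘Θ}/e`, `∫ e^{φ∘Θ} dμ₀ = ∫ e^{φ} dμ₀ = 1`). [folklore] -/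
theorem integral_posPart_flip_sub_tilted_le
    (hinv : μ₀.map (fun x : PhaseSpace N => (x.1, -x.2)) = μ₀) (φ : PhaseSpace N → ℝ)
    (hexp : Integrable (fun x => exp (φ x)) μ₀) (hZ1 : ∫ x, exp (φ x) ∂μ₀ = 1) :
    ∫ x, max (φ (x.1, -x.2) - φ x) 0 ∂(μ₀.tilted φ) ≤ exp (-1) := by
  have hexp' : Integrable (fun x => exp (φ (x.1, -x.2))) μ₀ :=
    (integrable_comp_flip_iff μ₀ hinv (fun x => exp (φ x))).2 hexp
  rw [integral_tilted]
  calc ∫ x, (exp (φ x) / ∫ y, exp (φ y) ∂μ₀) • max (φ (x.1, -x.2) - φ x) 0 ∂μ₀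
      = ∫ x, max (φ (x.1, -x.2) - φ x) 0 * exp (φ x) ∂μ₀ :=
        integral_congr_ae (ae_of_all _ fun x => by simp only [hZ1, div_one, smul_eq_mul]; ring)
    _ ≤ ∫ x, exp (-1) * exp (φ (x.1, -x.2)) ∂μ₀ :=
        integral_mono_of_nonneg (ae_of_all _ fun x => mul_nonneg (le_max_right _ _) (exp_pos _).le)
          (hexp'.const_mul _) (ae_of_all _ fun x => posPart_sub_mul_exp_le _ _)
    _ = exp (-1) := by rw [integral_const_mul, integral_exp_comp_flip μ₀ hinv φ, hZ1, mul_one]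

variable [IsProbabilityMeasure μ₀]

/-- **`∫ |φ − φ∘Θ| dμ ≤ KL(μ ‖ Θ_*μ) + 2/e`** once `φ − φ∘Θ ∈ L¹(μ)` (`|ψ| = ψ + 2ψ₋`,
`Negative.toReal_klDiv_flip_tilted`). [folklore] -/
theorem integral_abs_oddLogRatio_tilted_le
    (hinv : μ₀.map (fun x : PhaseSpace N => (x.1, -x.2)) = μ₀) {φ : PhaseSpace N → ℝ}
    (hφm : Measurable φ) (hexp : Integrable (fun x => exp (φ x)) μ₀) (hZ1 : ∫ x, exp (φ x) ∂μ₀ = 1)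
    (hint : Integrable (fun x => φ x - φ (x.1, -x.2)) (μ₀.tilted φ)) :
    ∫ x, |φ x - φ (x.1, -x.2)| ∂(μ₀.tilted φ) ≤
      (klDiv (μ₀.tilted φ) ((μ₀.tilted φ).map (fun x : PhaseSpace N => (x.1, -x.2)))).toReal +
        2 * exp (-1) := by
  have hneg : Integrable (fun x => max (φ (x.1, -x.2) - φ x) 0) (μ₀.tilted φ) := by
    refine hint.neg_part.congr (ae_of_all _ fun x => ?_)
    simp only [neg_sub]
  have hpt : ∀ x : PhaseSpace N,
      |φ x - φ (x.1, -x.2)| = (φ x - φ (x.1, -x.2)) + 2 * max (φ (x.1, -x.2) - φ x) 0 := by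
    intro x
    rcases le_or_gt (φ (x.1, -x.2)) (φ x) with h | h
    · rw [max_eq_right (by linarith), abs_of_nonneg (by linarith)]
      ring
    · rw [max_eq_left (by linarith), abs_of_neg (by linarith)]
      ring
  rw [toReal_klDiv_flip_tilted hinv hφm hexp]
  calc ∫ x, |φ x - φ (x.1, -x.2)| ∂(μ₀.tilted φ)
      = ∫ x, ((φ x - φ (x.1, -x.2)) + 2 * max (φ (x.1, -x.2) - φ x) 0) ∂(μ₀.tilted φ) :=
        integral_congr_ae (ae_of_all _ hpt)
    _ = ∫ x, (φ x - φ (x.1, -x.2)) ∂(μ₀.tilted φ) +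
          2 * ∫ x, max (φ (x.1, -x.2) - φ x) 0 ∂(μ₀.tilted φ) := by
        rw [integral_add hint (hneg.const_mul 2), integral_const_mul]
    _ ≤ ∫ x, (φ x - φ (x.1, -x.2)) ∂(μ₀.tilted φ) + 2 * exp (-1) := by
        linarith [integral_posPart_flip_sub_tilted_le μ₀ hinv φ hexp hZ1]

end NegativePart

/-- **`NessSnapshotKLPolyBound`** — a `δ`-POLYNOMIAL bound on the snapshot KL of the steady state
against its momentum flip: `KL(μ_{N,T+δ/2,T−δ/2} ‖ Θ_*μ_{N,T+δ/2,T−δ/2}) ≤ C |δ|^{−r}` for `0 < |δ| < δ₀`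
(far weaker than the `K δ²` of `K_fix`; in particular mere `δ`-uniform finiteness).
[route statement · this cell; NOT a literature fact] -/
def NessSnapshotKLPolyBound : Prop :=
  ∀ ω₂ lam β γ : ℝ, 0 < ω₂ → 0 < lam → 0 < β → 0 < γ →
    (∀ (N : ℕ) (T_L T_R : ℝ), 0 < T_L → 0 < T_R → ∀ μ ν : Measure (PhaseSpace N),
      (pinnedChain ω₂ lam β γ).IsSteadyState N T_L T_R μ →
      (pinnedChain ω₂ lam β γ).IsSteadyState N T_L T_R ν → μ = ν) →
    ∀ μ : (N : ℕ) → ℝ → ℝ → Measure (PhaseSpace N),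
      (∀ (N : ℕ) (T_L T_R : ℝ), 0 < T_L → 0 < T_R →
        (pinnedChain ω₂ lam β γ).IsSteadyState N T_L T_R (μ N T_L T_R)) →
      ∀ T : ℝ, 0 < T → ∀ N : ℕ, 2 ≤ N →
        ∃ δ₀ C r : ℝ, 0 < δ₀ ∧
          ∀ δ : ℝ, δ ≠ 0 → |δ| < δ₀ →
            klDiv (μ N (T + δ / 2) (T - δ / 2))
                ((μ N (T + δ / 2) (T - δ / 2)).map (fun x : PhaseSpace N => (x.1, -x.2))) ≤
              ENNReal.ofReal (C * |δ| ^ (-r))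

/-- **The unsigned `p = 1` rung is below the target: `NessSnapshotKLPolyBound ⟹ A2₁`**
(`∫ |ψ| dμ_δ ≤ KL + 2/e ≤ (C⁺ + 2/e)|δ|^{−r⁺}` for `|δ| < 1`). [folklore] -/
theorem nessOddLogRatioMoment_one_of_klPolyBound (h : NessSnapshotKLPolyBound) :
    NessOddLogRatioMoment 1 := by
  intro ω₂ lam β γ hω hl hβ hγ hU μ hμ T hT N hN
  obtain ⟨δ₀, C, r, hδ₀, hKL⟩ := h ω₂ lam β γ hω hl hβ hγ hU μ hμ T hT N hN
  set P := pinnedChain ω₂ lam β γ with hP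
  set μT := P.gibbsMeasure N T with hμT
  haveI hprob : IsProbabilityMeasure μT :=
    pinnedChain_isProbabilityMeasure_gibbsMeasure hω hl.le hβ.le γ N hT
  have hinv : μT.map (fun x : PhaseSpace N => (x.1, -x.2)) = μT := gibbsMeasure_map_flip P N T
  have h2T : (0 : ℝ) < 2 * T := by positivity
  refine ⟨min (min δ₀ 1) (2 * T), max C 0 + 2 * exp (-1), max r 0, lt_min (lt_min hδ₀ one_pos) h2T,
    fun δ hδ hδ' φ hφm hrew => ?_⟩
  have hδ₀' : |δ| < δ₀ := hδ'.trans_le ((min_le_left _ _).trans (min_le_left _ _))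
  have hδ1 : |δ| < 1 := hδ'.trans_le ((min_le_left _ _).trans (min_le_right _ _))
  have hδT : |δ| < 2 * T := hδ'.trans_le (min_le_right _ _)
  have hδpos : 0 < |δ| := abs_pos.2 hδ
  obtain ⟨hlo, hhi⟩ := abs_lt.1 hδT
  haveI : IsProbabilityMeasure (μ N (T + δ / 2) (T - δ / 2)) :=
    (hμ N _ _ (by linarith) (by linarith)).1
  have hKLδ := hKL δ hδ hδ₀'
  obtain ⟨hi, hz1, htilt⟩ := tilted_of_withDensity_exp hφm hrew
  rw [htilt] at hKLδ ⊢
  have hfin : klDiv (μT.tilted φ) ((μT.tilted φ).map (fun x : PhaseSpace N => (x.1, -x.2))) ≠ ∞ :=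
    ne_top_of_le_ne_top ENNReal.ofReal_ne_top hKLδ
  have hint : Integrable (fun x => φ x - φ (x.1, -x.2)) (μT.tilted φ) :=
    (klDiv_flip_tilted_ne_top_iff hinv hφm hi).1 hfin
  have hint1 : Integrable (fun x => |φ x - φ (x.1, -x.2)| ^ (1 : ℝ)) (μT.tilted φ) := by
    simpa only [Real.rpow_one] using hint.abs
  refine ⟨hint1, ?_⟩
  simp only [Real.rpow_one]
  have hC0 : 0 ≤ max C 0 * |δ| ^ (-r) := mul_nonneg (le_max_right _ _) (Real.rpow_nonneg (abs_nonneg _) _)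
  have htr : (klDiv (μT.tilted φ) ((μT.tilted φ).map (fun x : PhaseSpace N => (x.1, -x.2)))).toReal ≤
      max C 0 * |δ| ^ (-r) :=
    ENNReal.toReal_le_of_le_ofReal hC0 (hKLδ.trans (ENNReal.ofReal_le_ofReal
      (mul_le_mul_of_nonneg_right (le_max_left _ _) (Real.rpow_nonneg (abs_nonneg _) _))))
  have hr1 : 1 ≤ |δ| ^ (-(max r 0)) :=
    Real.one_le_rpow_of_pos_of_le_one_of_nonpos hδpos hδ1.le (neg_nonpos.2 (le_max_right _ _))
  have hr2 : |δ| ^ (-r) ≤ |δ| ^ (-(max r 0)) :=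
    Real.rpow_le_rpow_of_exponent_ge hδpos hδ1.le (neg_le_neg (le_max_left _ _))
  have hC : max C 0 * |δ| ^ (-r) ≤ max C 0 * |δ| ^ (-(max r 0)) :=
    mul_le_mul_of_nonneg_left hr2 (le_max_right _ _)
  have he : 0 ≤ 2 * exp (-1) := by positivity
  calc ∫ x, |φ x - φ (x.1, -x.2)| ∂(μT.tilted φ)
      ≤ (klDiv (μT.tilted φ) ((μT.tilted φ).map (fun x : PhaseSpace N => (x.1, -x.2)))).toReal +
          2 * exp (-1) := integral_abs_oddLogRatio_tilted_le μT hinv hφm hi hz1 hint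
    _ ≤ max C 0 * |δ| ^ (-(max r 0)) + 2 * exp (-1) * |δ| ^ (-(max r 0)) := by
        nlinarith [htr, hC, hr1, he]
    _ = (max C 0 + 2 * exp (-1)) * |δ| ^ (-(max r 0)) := by ring

end Summit.AtomisticToContinuum.FouriersLaw.Theorems.ExtensiveSnapshotIrreversibility.EnergyWindow

end
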